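import Mathlib
import HarnessLib

/-!
# ValiantsHypothesis / LacunarySymmetroid — crux `MatrixDescartes` (stmt-ValiantsHypothesis-18050, V1),
# line «osculation-law», `stub_recursion` R6(a): (D1) LINE-GENERICITY OF `det ≢ 0`

val-lit-p7 g13's sizing memo `HOME/lmr/NOTE-p7g13-18050-GP-density-sizing.md` §4 splits the general-position
DENSITY residue of `stub_recursion` along the segment `S_ε := (1 − ε)·S + ε·W` from an arbitrary pencil `S` to
the explicit witness `W` (§3).  Condition (D1) is «`det(pencil d S_ε) ≢ 0` for all but finitely many `ε`»,
granted `det(pencil d W) ≢ 0`.  This file proves it (named sub-lemma, bus 2026-08-28 l.≈8149):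

* `eval_det_pencil_gen` — `det` commutes with evaluation for the pencil `Σ_l X^{d l} • (S l).map C` over any
  finite index type (the tree's `SymmetroidDescartes.eval_det_pencil` is the `Fin m` case);
* `segment_pencil_eval` — at a fixed abscissa `t₀` the segment is AFFINE in `ε`:
  `Σ t₀^{d l}•((1−ε)S_l + εW_l) = A + ε•B`, `A = Σ t₀^{d l}•S_l`, `B = Σ t₀^{d l}•(W_l − S_l)`;
* ★ `finite_bad_eps_det` — if `det(pencil d W) ≠ 0` then `{ε | det(pencil d S_ε) = 0}` is FINITE.  Route
  (univariate throughout): pick `t₀` with `det(pencil d W)(t₀) ≠ 0` (`Polynomial.funext` over `ℝ`); then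
  `ε ↦ det(pencil d S_ε)(t₀) = det(A + ε B)` is ONE real polynomial in `ε` (`RingHom.map_det` on
  `A.map C + X • B.map C`), nonzero at `ε = 1`, and every bad `ε` is one of its roots;
* `exists_good_eps_Ioo` — hence good parameters `ε` exist in every interval `(0, δ)` (cofiniteness ⇒ density);
* `finite_bad_eps_det_symm` — the symmetric-letter bookkeeping (`S_ε` is symmetric when `S`, `W` are).

Honest framing: helper bookkeeping for ONE of three density conditions of an UNREGISTERED residue stub of a V1 law
line; `stub_recursion`, the LAW `stub_osculationLaw`, the crux `MatrixDescartes`, Conjecture B and `VP ≠ VNP`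
are OPEN / NOT proved.  No definitions, no named facts; Mathlib only.
-/

-- `Summit.ValiantsHypothesis.ValiantsHypothesis.…` is the tree's mandated single-conjunct layout (Sub = Summit).
set_option linter.dupNamespace false

noncomputable section

namespace Summit.ValiantsHypothesis.ValiantsHypothesis.Theorems.LacunarySymmetroidMatrixDescartes

namespace OsculationGeneric

open Polynomial Matrix
open scoped BigOperators

variable {ι : Type*} [Fintype ι] [DecidableEq ι]

/-- `det` commutes with evaluation for the pencil `Σ_l X^{d l} • (S l).map C` (any finite index type).
[folklore] -/
theorem eval_det_pencil_gen {K : ℕ} (d : Fin K → ℕ) (S : Fin K → Matrix ι ι ℝ) (t : ℝ) :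
    ((∑ l, (X : ℝ[X]) ^ d l • (S l).map Polynomial.C).det).eval t = (∑ l, t ^ d l • S l).det := by
  have h := RingHom.map_det (Polynomial.evalRingHom t) (∑ l, (X : ℝ[X]) ^ d l • (S l).map Polynomial.C)
  rw [Polynomial.coe_evalRingHom] at h
  rw [h, map_sum]
  congr 1
  refine Finset.sum_congr rfl fun l _ => ?_
  ext i j
  simp [Matrix.smul_apply]
  ring

/-- `det (A.map C + X • B.map C)` evaluates at `ε` to `det (A + ε • B)`. [folklore] -/
theorem eval_det_affine (A B : Matrix ι ι ℝ) (ε : ℝ) :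
    ((A.map Polynomial.C + (X : ℝ[X]) • B.map Polynomial.C).det).eval ε = (A + ε • B).det := by
  have h := RingHom.map_det (Polynomial.evalRingHom ε) (A.map Polynomial.C + (X : ℝ[X]) • B.map Polynomial.C)
  rw [Polynomial.coe_evalRingHom] at h
  rw [h]
  congr 1
  ext i j
  simp [Matrix.smul_apply]
  ring

omit [Fintype ι] [DecidableEq ι] in
/-- At a fixed abscissa the segment pencil is affine in `ε`. [folklore] -/
theorem segment_pencil_eval {K : ℕ} (d : Fin K → ℕ) (S W : Fin K → Matrix ι ι ℝ) (t ε : ℝ) :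
    (∑ l, t ^ d l • ((1 - ε) • S l + ε • W l)) =
      (∑ l, t ^ d l • S l) + ε • ∑ l, t ^ d l • (W l - S l) := by
  rw [Finset.smul_sum, ← Finset.sum_add_distrib]
  refine Finset.sum_congr rfl fun l _ => ?_
  ext i j
  simp [Matrix.smul_apply, Matrix.add_apply, Matrix.sub_apply]
  ring

/-- **(D1) Line-genericity of `det ≢ 0`.**  If `det(pencil d W) ≠ 0` then along the segment
`S_ε = (1−ε)S + εW` the determinant of the pencil vanishes identically for only FINITELY many `ε`. [folklore] -/
theorem finite_bad_eps_det {K : ℕ} (d : Fin K → ℕ) (S W : Fin K → Matrix ι ι ℝ)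
    (hW : (∑ l, (X : ℝ[X]) ^ d l • (W l).map Polynomial.C).det ≠ 0) :
    {ε : ℝ | (∑ l, (X : ℝ[X]) ^ d l • ((1 - ε) • S l + ε • W l).map Polynomial.C).det = 0}.Finite := by
  classical
  -- an abscissa where `det(pencil d W)` does not vanish
  obtain ⟨t₀, ht₀⟩ : ∃ t₀ : ℝ, ((∑ l, (X : ℝ[X]) ^ d l • (W l).map Polynomial.C).det).eval t₀ ≠ 0 := by
    by_contra h
    push Not at h
    exact hW (Polynomial.funext fun t => by rw [h t, eval_zero])
  -- the univariate polynomial `ε ↦ det(pencil d S_ε)(t₀)`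
  set A : Matrix ι ι ℝ := ∑ l, t₀ ^ d l • S l with hA
  set B : Matrix ι ι ℝ := ∑ l, t₀ ^ d l • (W l - S l) with hB
  set p : ℝ[X] := (A.map Polynomial.C + (X : ℝ[X]) • B.map Polynomial.C).det with hp
  have hkey : ∀ ε : ℝ,
      ((∑ l, (X : ℝ[X]) ^ d l • ((1 - ε) • S l + ε • W l).map Polynomial.C).det).eval t₀ = p.eval ε := by
    intro ε
    rw [eval_det_pencil_gen, segment_pencil_eval, hp, eval_det_affine]
  have hp1 : p.eval 1 ≠ 0 := by
    rw [← hkey 1]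
    have h1 : ∀ l, (1 - (1 : ℝ)) • S l + (1 : ℝ) • W l = W l := by
      intro l; simp
    simp only [h1]
    exact ht₀
  have hp0 : p ≠ 0 := fun h => hp1 (by rw [h, eval_zero])
  refine (p.roots.toFinset.finite_toSet).subset fun ε hε => ?_
  rw [Finset.mem_coe, Multiset.mem_toFinset, mem_roots hp0, IsRoot.def, ← hkey ε]
  rw [Set.mem_setOf_eq] at hε
  rw [hε, eval_zero]

/-- **Good parameters near `0`.**  Under the same hypothesis every interval `(0, δ)` contains a good `ε`
(one with `det(pencil d S_ε) ≠ 0`). [folklore] -/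
theorem exists_good_eps_Ioo {K : ℕ} (d : Fin K → ℕ) (S W : Fin K → Matrix ι ι ℝ)
    (hW : (∑ l, (X : ℝ[X]) ^ d l • (W l).map Polynomial.C).det ≠ 0) {δ : ℝ} (hδ : 0 < δ) :
    ∃ ε : ℝ, 0 < ε ∧ ε < δ ∧
      (∑ l, (X : ℝ[X]) ^ d l • ((1 - ε) • S l + ε • W l).map Polynomial.C).det ≠ 0 := by
  have hinf : (Set.Ioo (0 : ℝ) δ).Infinite := Set.Ioo_infinite hδ
  obtain ⟨ε, hε, hgood⟩ := (hinf.sdiff (finite_bad_eps_det d S W hW)).nonempty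
  exact ⟨ε, hε.1, hε.2, hgood⟩

omit [Fintype ι] [DecidableEq ι] in
/-- Symmetric letters stay symmetric along the segment. [folklore] -/
theorem isSymm_segment {K : ℕ} (S W : Fin K → Matrix ι ι ℝ) (hS : ∀ l, (S l).IsSymm)
    (hWs : ∀ l, (W l).IsSymm) (ε : ℝ) (l : Fin K) : ((1 - ε) • S l + ε • W l).IsSymm :=
  ((hS l).smul _).add ((hWs l).smul _)

/-- **(D1), symmetric form**: for symmetric `S`, `W` with `det(pencil d W) ≠ 0`, every interval `(0, δ)` holds an
`ε` whose (symmetric) segment pencil `S_ε` has `det ≢ 0`. [folklore] -/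
theorem finite_bad_eps_det_symm {K : ℕ} (d : Fin K → ℕ) (S W : Fin K → Matrix ι ι ℝ)
    (hS : ∀ l, (S l).IsSymm) (hWs : ∀ l, (W l).IsSymm)
    (hW : (∑ l, (X : ℝ[X]) ^ d l • (W l).map Polynomial.C).det ≠ 0) {δ : ℝ} (hδ : 0 < δ) :
    ∃ ε : ℝ, 0 < ε ∧ ε < δ ∧ (∀ l, ((1 - ε) • S l + ε • W l).IsSymm) ∧
      (∑ l, (X : ℝ[X]) ^ d l • ((1 - ε) • S l + ε • W l).map Polynomial.C).det ≠ 0 := by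
  obtain ⟨ε, h0, hδ', hgood⟩ := exists_good_eps_Ioo d S W hW hδ
  exact ⟨ε, h0, hδ', isSymm_segment S W hS hWs ε, hgood⟩

end OsculationGeneric

end Summit.ValiantsHypothesis.ValiantsHypothesis.Theorems.LacunarySymmetroidMatrixDescartes
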